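import Summits.BirchSwinnertonDyer.Rank1Residual.O5.O5FlatKummerNormalForm
import HarnessLib

/-!
# O5 — the Case-S Kummer law T30.6 RE-TYPED under T30.1 (f)'s sign normalisation `A₃ ≡ 1 (mod 3)` (v2 node; ERRATUM for v1)
(cell `b2b-bsdres`, lane CLASS-CLOSURE, class O5; typer of record cc-typer-5 GEN 17; docket cc-lead ⟦gen66⟧ (2′) ADDENDUM (B) = (c30a),
 `class-closure/OWNERS.md` l.820; wording of record = the typer's (R′) word HOME/INBOX.md 2026-08-22 l.12799 (= n1011-p18 GEN 14's repaired
 statement `C′`, option 1, l.12750; n1011 lead GEN 11 l.12767 'the repaired statement with `A₃ % 3 = 1` is the typer's re-type') and the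
 AUTHOR'S WORD o5-r1 GEN 21 l.12786 ('the REPAIRED C′ = the same law WITH `A₃ % 3 = 1` bound … is the intended T30.6; new decl, refuted
 decl left as the settled negative edge');
 sibling of `O5/O5FlatKummerNormalForm.lean` (A-O5-28, 398 l.) for `lint.size` — no parent decl is removed, renamed or re-worded here;
 shape = the (c28) precedent `O5/FlexNormalFormCaseNValLaw.lean`.)

HONEST FRAMING (cell `b2b-bsdres`, run/shared/lean/b2b/bsd-rank1-residual/, verbatim in every file): the goal of the cell is
to DELETE the COMBINATION-SHAPED residual classes of the Birch–Swinnerton-Dyer formula for ALL analytic-rank `≤ 1` elliptic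
curves over `ℚ` — "full BSD formula for every rank `≤ 1` curve in class `C`" assembled STRICTLY from published theorems — so that
the rank-`≤ 1` remainder becomes exactly the CONSTRUCTION-SHAPED classes, which are TYPED (missing-input `Prop`s), NOT attempted.
This is not "finishing BSD". Lane CLASS-CLOSURE: research routes; census output is EVIDENCE / conjecture items, never a Literature
fact; nothing is booked; no mark of `RESIDUAL-MAP.md` moves; O5 stays OPEN.

ERRATUM (located by n1011-p18 GEN 14, HOME/INBOX.md l.12750; ratified by n1011 lead GEN 11 l.12767; CONFIRMED 'refuted-MISSTATED from the
author's side' by o5-r1 GEN 21 l.12786; concurred by the typer l.12799).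
o5-r1 GEN 13's T30.6 / T30.7 (`HOME/b2b-bsdres-o5-r1/gen13/T30-FLAT-KUMMER-NORMAL-FORM.md` §1) is stated for the flex normal form
`y² + 3b·xy + 3ᵃA₃·y = x³` (Case S: `a ∈ {1, 2}`) with the UNIT PART `A₃` NORMALISED `≡ 1 (mod 3)` — T30.1 (f): the change `u = −1`
maps `(b, A₃) ↦ (−b, −A₃)` and multiplies `y` by `−1`, a cube; o5-r1's frozen census block normalises the same way
(`gen13/pk19/k19_block.gp` l.5 / l.17: `eps = −1` iff the unit part is `≡ 2 (mod 3)`, `A3n := eps·A3u`, `b := eps·A1/3`).  The v1 node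
`FlexNFCaseSKummerLawThree` (`O5/O5FlatKummerNormalForm.lean` l.311, typed by cc-typer-5 GEN 10 under A-O5-28) binds only
`¬ 3 ∣ A₃` and reads the cell from `cellS a b`, i.e. from `b mod 3` alone; for `a = 1` the `k`-column of `cellS` is NOT `b ↦ −b`
symmetric (`k = 1` iff `b ≡ 2`, `k = 2` iff `b ≢ 2 (mod 3)`), so on `A₃ ≡ 2 (mod 3)` the v1 node asserts the law of the WRONG cell:
FALSE AS TYPED.  WITNESS (p18, kernel): `(a, b, A₃) = (1, 2, 2)`, the curve `y² + 6xy + 6y = x³` (normalised `(b, A₃) = (−2, −2)`,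
`b ≡ 1 (mod 3)`, true cell `(2, plane)`): `cellS 1 2` has `k = 1`, so v1 demands `NFKummerInLineOfA₃ 2 2 1` (every `y(P)` is
`6ᵉ·w³`), refuted by the Hensel point `(ξ, 4)`, `ξ³ − 24ξ − 40 = 0`, `ξ ≡ 7 (mod 9)` (`4` is a unit with `4² ≢ 1 (mod 9)`, not a
cube).  NEGATIVE EDGE = n1011-p18's `FlexNormalForm.not_flexNFCaseSKummerLawThree` (`O5/FlexNFCaseSKummerLawThreeSign.lean`).
This is a TYPING SLIP (the binder of T30.1 (f) dropped when A-O5-28 was typed), NOT a slip of T30.6 and NOT mathematics lost: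
K19-h's `0` exceptions on `20 396` Case-S rows were scored on NORMALISED records, so the census supports the v2 node below exactly
as it supported the law of T30 §1.  UNAFFECTED: T30.5 `FlexNFCaseSKodairaLawThree` (PROVED, p332637: the Kodaira / `v₃Δ` / `f₃`
columns of `cellS` are `b ↦ −b` symmetric), the Case-N nodes (they bind `A₃ % 3 = 1`), and the `a = 2` clause of v1 (its
`k`-column reads `3 ∣ b`, symmetric) — the v2 node nevertheless normalises both `a` uniformly, as T30 §1 does.  The v1 node STAYS
in its file as a settled negative edge; its ERRATUM banner and the drop of its `@[conjecture]` attribute are a DOC / ATTRIBUTE-ONLY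
touch of the parent docketed separately (attribute dropped only after the refutation has a pid — the (c28) rule).

WHAT IS TYPED: **`@[conjecture] FlexNFCaseSKummerSignedLawThree`** (T30.6 v2 = the v1 text with the binder `¬ (3 : ℤ) ∣ A₃`
REPLACED by `A₃ % 3 = 1`; THEOREM-CANDIDATE, EVIDENCE-labelled as v1; n1011-p18 GEN 14's banked siblings
`FlexNFCaseSKummerExistsThree.lean` — `nfKummerHasRamified_S`, `nfKummerHasUnit_S_of_cellS`, binders `(ha : a = 1 ∨ a = 2)
(hA : A₃ % 3 = 1)` — discharge conjuncts 1 and 3 token for token; conjunct 2, `k = 1 → NFKummerInLineOfA₃` ('`E = ⟨P₀⟩ + E⁰`,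
`δ(E⁰) = ⟨[y(Q₁)]⟩`'), is NOT yet in the kernel), plus PROVED bookkeeping (theorems, no `sorry`; typer appendix as §T of the
parent): the SIGN SYMMETRY of the equation and of the three Kummer predicates under `(b, A₃, y) ↦ (−b, −A₃, −y)` (`−1` is a cube,
`v₃(−y) = v₃(y)`), `cellS_congr` (`cellS a b` depends on `b mod 3` only), and the ANY-SIGN READING
`kummerLawS_of_signed` — p18's `C′` option 2 (cell read at `cellS a (b·A₃)`, i.e. at `b·χ(A₃)`, `χ(A₃) ≡ A₃ (mod 3)`, under the
bare binder `¬ 3 ∣ A₃`) as a THEOREM over the v2 node, with `signedLaw_iff_anySign` recording that options 1 and 2 are EQUIVALENT,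
so the normalisation loses no curve.  `@[conjecture]` × 1; 0 further `def`s; 0 Literature facts; net named-fact debt 0. STATUS ⟦cc-typer-5 GEN 18, rider (r9)⟧: PROVED AS TYPED by n1011-p18 GEN 16 (`flexNFCaseSKummerSignedLawThree_holds`, `O5/FlexNFCaseSKummerSignedLawThreeProofs.lean` p346262) — `@[conjecture]` attribute dropped, statement bytes unchanged; `@[conjecture]` × 0 now.
DEDUP (`lean search`): `FlexNFCaseSKummerSignedLawThree`, `onNF_neg_iff`, `cellS_congr`, `kummerLawS_of_signed` — no match
(`v₃(−t) = v₃(t)` exists twice in unrelated Literature files as `valuation_neg'`/`valuation_neg''`; a 6-line private copy is kept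
here rather than importing a 2-descent module into O5).
References: as the parent — J. H. Silverman, ATAEC IV.9.4 (Tate's algorithm) [SilvermanATAEC1994]; H. Cohen, F. Pazuki,
3-descent Def. 1.3 / Prop. 2.2 [CohenPazuki2009ThreeDescent]; S. Gajović, L. Radičević, M. Verzobio 2025 Thm. 55
[GajovicRadicevicVerzobio2025]; Bhargava–Klagsbrun–Lemke Oliver–Shnidman Thm. 10.5 [BKLS2019ThreeIsogenySelmer].
-/

open WeierstrassCurve Literature.NumberTheory.DiophantineGeometry

namespace Summit.BirchSwinnertonDyer.Rank1Residual.O5.FlexNormalForm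

/-! ## §1 T30.6 v2 (Case S of the flex normal form `y² + 3b·xy + 3ᵃA₃·y = x³`, `a ∈ {1, 2}`, `A₃ ≡ 1 (mod 3)`) -/

/-- **T30.6 v2 `FlexNFCaseSKummerSignedLawThree` — THEOREM: PROVED AS TYPED by n1011-p18 GEN 16, `FlexNormalForm.flexNFCaseSKummerSignedLawThree_holds`
(`O5/FlexNFCaseSKummerSignedLawThreeProofs.lean`, p346262 ACCEPTED; siblings `O5/FlexNFCaseSKummerExistsThree.lean` p345436 + `O5/FlexNFCaseSKummerCuspThree.lean` p345740; binders verbatim, axioms standard); `@[conjecture]` DROPPED ⟦cc-typer-5 GEN 18, rider (r9) of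
cc-lead ⟦gen71⟧ (2′) / n1011 lead R5-174⟧, statement bytes unchanged; the PROVED any-sign corollary `kummerLawS_of_signed` below is thereby
unconditional; census = EVIDENCE; a `_holds` closes no pair; O5 OPEN.**
**(As typed: THEOREM-CANDIDATE; = the v1 node `FlexNFCaseSKummerLawThree` with its binder
`¬ (3 : ℤ) ∣ A₃` REPLACED by T30.1 (f)'s sign normalisation `A₃ % 3 = 1`; proof T30 §1 (Case S: `P₀ ∉ E⁰`, `c₃ = 3` ⇒
`E = ⟨P₀⟩ + E⁰`, `t = ⟨[3ᵃA₃]⟩ + ⟨[y(Q₁)]⟩`, `y(Q₁) ≡ ±1 + 3(b+1)` resp. `±1 + 3b (mod 9)` on `x ≡ 1 (mod 3)`); EVIDENCE P-K19).**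
In Case S (sign-normalised) the Kummer image `t = δ_φ̂(E(ℚ₃))` always contains the très ramifié class `[3ᵃA₃] = δ(P₀)⁻¹`; it is the
LINE `⟨[3ᵃA₃]⟩` when `cellS` says `k = 1` (`a = 1, b ≡ 2` / `a = 2, b ≡ 0 (mod 3)`) and the whole plane when `k = 2`.  Conjuncts 1
and 3 are kernel theorems of n1011-p18 GEN 14 (`nfKummerHasRamified_S`, `nfKummerHasUnit_S_of_cellS`, banked
`HOME/b2b-bsdres-n1011-p18/g14/FlexNFCaseSKummerExistsThree.lean`); conjunct 2 is the open `∀`-half.  The any-sign reading is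
the PROVED corollary `kummerLawS_of_signed` below.  Why it might fail: a component point with `y` a cube times `[3ᵃA₃]^e` in a
`k = 2` cell, or a non-`⟨P₀⟩ + E⁰` decomposition (census: none in 20 396 rows).  SUPERSEDES `FlexNFCaseSKummerLawThree` — FALSE
AS TYPED on `A₃ ≡ 2 (mod 3)`, witness `(1, 2, 2)`; negative edge `FlexNormalForm.not_flexNFCaseSKummerLawThree`
(`O5/FlexNFCaseSKummerLawThreeSign.lean`, n1011-p18 GEN 14; pid quoted in the ERRATUM touch of the parent once landed).  No proof of this
node is claimed here; K19-h is EVIDENCE for the NORMALISED law only.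
[cite: GajovicRadicevicVerzobio2025, Thm. 55 (arXiv:2502.08583 p. 21)] [cite: BKLS2019ThreeIsogenySelmer, Thm. 10.5 (arXiv:1709.09790 p. 15)]
[cite: CohenPazuki2009ThreeDescent, Def. 1.3 and Prop. 2.2 (arXiv:0903.4963 pp. 4–5)]
[evidence: census cell O5, o5-r1 GEN 13, P-K19 kit j142073 (pre-registered gen13/P-K19-PREREG.md 29ea23ef8cc75c6f, frozen scorer 21d36208e1c08241, block `k19_block.gp` normalising the unit part of A3 ≡ 1 (mod 3)): K19-h 20 396/20 396 Case-S rows have (k, t) = (cellS.k, cellS.t) with t ∋ [3ᵃA₃]; cells IV v₃Δ=6 (1,L) 2 659, (2,P) 2 665; IV v₃Δ=7 (2,P) 2 412; IV* v₃Δ=11 (1,L) 3 580; IV* v₃Δ=9 (2,P) 9 080; 0 exceptions] -/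
def FlexNFCaseSKummerSignedLawThree : Prop :=
  ∀ (a : ℕ) (b A₃ : ℤ), (a = 1 ∨ a = 2) → A₃ % 3 = 1 →
    NFKummerHasRamified b A₃ a ∧
      ((cellS a b).k = 1 → NFKummerInLineOfA₃ b A₃ a) ∧ ((cellS a b).k = 2 → NFKummerHasUnit b A₃ a)

/-- The slip in one `decide`: for `a = 1` the `k`-column of `cellS` is not `b ↦ −b` symmetric (`b ≡ 2 ↦ k = 1`, `b ≡ 1 ↦ k = 2`),
while for `a = 2` it is (`k` reads `3 ∣ b`). [folklore] -/
example : (cellS 1 2).k = 1 ∧ (cellS 1 (-2)).k = 2 ∧ (cellS 2 1).k = (cellS 2 (-1)).k ∧ (cellS 2 3).k = (cellS 2 (-3)).k := by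
  decide

/-! ## §2 PROVED bookkeeping: the sign symmetry `(b, A₃, y) ↦ (−b, −A₃, −y)` of T30.1 (f) and the any-sign reading -/

section Sign

/-- `v₃(−t) = v₃(t)` in `ℚ₃` (private copy; cf. `valuation_neg'` in `Literature/…/TwoDescentLocalPadic.lean`). [folklore] -/
private theorem valuation_neg₃ (t : ℚ_[3]) : (-t).valuation = t.valuation := by
  by_cases ht : t = 0
  · rw [ht, neg_zero]
  · have h1 : (-1 : ℚ_[3]) ≠ 0 := neg_ne_zero.mpr one_ne_zero
    have hv1 : (-1 : ℚ_[3]).valuation = 0 := by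
      rw [show (-1 : ℚ_[3]) = ((-1 : ℤ) : ℚ_[3]) by push_cast; rfl, Padic.valuation_intCast]
      exact_mod_cast padicValInt.eq_zero_of_not_dvd (p := 3) (z := -1) (by decide)
    rw [← neg_one_mul, Padic.valuation_mul h1 ht, hv1, zero_add]

/-- T30.1 (f) on the equation: `(x, −y)` lies on the normal form of `(−b, −A₃)` iff `(x, y)` lies on that of `(b, A₃)`
(same `a`). [folklore] -/
theorem onNF_neg_iff (b A₃ : ℤ) (a : ℕ) (x y : ℚ_[3]) : OnNF (-b) (-A₃) a x (-y) ↔ OnNF b A₃ a x y := by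
  simp only [OnNF]
  push_cast
  constructor <;> intro h <;> linear_combination h

/-- Sign transport of `NFKummerHasRamified` (`v₃(−y) = v₃(y)`). [folklore] -/
theorem nfKummerHasRamified_of_neg (b A₃ : ℤ) (a : ℕ) (h : NFKummerHasRamified (-b) (-A₃) a) :
    NFKummerHasRamified b A₃ a := by
  obtain ⟨x, y, hxy, hx, hy, hv⟩ := h
  refine ⟨x, -y, (onNF_neg_iff b A₃ a x (-y)).1 (by simpa using hxy), hx, neg_ne_zero.2 hy, ?_⟩
  rwa [valuation_neg₃]

/-- Sign transport of `NFKummerHasUnit` (`−1` is a cube). [folklore] -/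
theorem nfKummerHasUnit_of_neg (b A₃ : ℤ) (a : ℕ) (h : NFKummerHasUnit (-b) (-A₃) a) : NFKummerHasUnit b A₃ a := by
  obtain ⟨x, y, hxy, hx, hv, hc⟩ := h
  refine ⟨x, -y, (onNF_neg_iff b A₃ a x (-y)).1 (by simpa using hxy), hx, by rwa [valuation_neg₃], ?_⟩
  rintro ⟨w, hw⟩
  exact hc ⟨-w, by linear_combination -hw⟩

/-- Sign transport of `NFKummerInLineOfA₃` (the line of `[3ᵃ(−A₃)]` is the line of `[3ᵃA₃]`: `(−X)ᵉ = ±Xᵉ` by the parity of `e`,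
and `−w³ = (−w)³`). [folklore] -/
theorem nfKummerInLineOfA₃_of_neg (b A₃ : ℤ) (a : ℕ) (h : NFKummerInLineOfA₃ (-b) (-A₃) a) :
    NFKummerInLineOfA₃ b A₃ a := by
  intro x y hxy hx
  obtain ⟨e, w, hw⟩ := h x (-y) ((onNF_neg_iff b A₃ a x y).2 hxy) hx
  push_cast at hw
  rw [show (3 : ℚ_[3]) ^ a * -(A₃ : ℚ_[3]) = -((3 : ℚ_[3]) ^ a * (A₃ : ℚ_[3])) by ring] at hw
  rcases Nat.even_or_odd e with he | ho
  · rw [he.neg_pow] at hw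
    exact ⟨e, -w, by linear_combination -hw⟩
  · rw [ho.neg_pow] at hw
    exact ⟨e, w, by linear_combination -hw⟩

/-- The three transports as equivalences (apply the one-way lemmas to `(−b, −A₃)` and use `−(−b) = b`). [folklore] -/
theorem nfKummer_neg_iff (b A₃ : ℤ) (a : ℕ) :
    (NFKummerHasRamified (-b) (-A₃) a ↔ NFKummerHasRamified b A₃ a) ∧
      (NFKummerHasUnit (-b) (-A₃) a ↔ NFKummerHasUnit b A₃ a) ∧
        (NFKummerInLineOfA₃ (-b) (-A₃) a ↔ NFKummerInLineOfA₃ b A₃ a) :=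
  ⟨⟨nfKummerHasRamified_of_neg b A₃ a, fun h => nfKummerHasRamified_of_neg (-b) (-A₃) a (by simpa using h)⟩,
    ⟨nfKummerHasUnit_of_neg b A₃ a, fun h => nfKummerHasUnit_of_neg (-b) (-A₃) a (by simpa using h)⟩,
    ⟨nfKummerInLineOfA₃_of_neg b A₃ a, fun h => nfKummerInLineOfA₃_of_neg (-b) (-A₃) a (by simpa using h)⟩⟩

/-- `cellS a b` depends on `b mod 3` only. [folklore] -/
theorem cellS_congr (a : ℕ) {b b' : ℤ} (h : b % 3 = b' % 3) : cellS a b = cellS a b' := by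
  unfold cellS
  simp only [h]

/-- **The ANY-SIGN reading of T30.6 (n1011-p18's `C′` option 2) is a THEOREM over the v2 node.**  For every `a ∈ {1, 2}`, `b ∈ ℤ`
and every `A₃` prime to `3` (no normalisation), the Kummer image of `y² + 3b·xy + 3ᵃA₃·y = x³` contains a ramified class, and it is
the line of `[3ᵃA₃]` / the plane according as the cell read at `b·A₃` (i.e. at `b·χ(A₃)`, `χ(A₃) ≡ A₃ (mod 3)`: the `b` of the
normalised model up to the symmetric sign) has `k = 1` / `k = 2`.  Proof: for `A₃ ≡ 1` this is the node; for `A₃ ≡ 2` apply the node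
to `(−b, −A₃)` and transport by `nfKummer_neg_iff`. [folklore] -/
theorem kummerLawS_of_signed (h : FlexNFCaseSKummerSignedLawThree) (a : ℕ) (b A₃ : ℤ) (ha : a = 1 ∨ a = 2)
    (hA : ¬ (3 : ℤ) ∣ A₃) :
    NFKummerHasRamified b A₃ a ∧
      ((cellS a (b * A₃)).k = 1 → NFKummerInLineOfA₃ b A₃ a) ∧ ((cellS a (b * A₃)).k = 2 → NFKummerHasUnit b A₃ a) := by
  rcases (show A₃ % 3 = 1 ∨ A₃ % 3 = 2 by omega) with h1 | h2
  · have hc : cellS a (b * A₃) = cellS a b := cellS_congr a (by rw [Int.mul_emod, h1]; omega)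
    rw [hc]
    exact h a b A₃ ha h1
  · obtain ⟨hR, hL, hU⟩ := h a (-b) (-A₃) ha (by omega)
    have hc : cellS a (b * A₃) = cellS a (-b) := cellS_congr a (by rw [Int.mul_emod, h2]; omega)
    rw [hc]
    exact ⟨nfKummerHasRamified_of_neg b A₃ a hR, fun hk => nfKummerInLineOfA₃_of_neg b A₃ a (hL hk),
      fun hk => nfKummerHasUnit_of_neg b A₃ a (hU hk)⟩

/-- Options 1 and 2 of the repair are EQUIVALENT statements (the normalised node loses no curve): for `A₃ ≡ 1 (mod 3)` the cell at
`b·A₃` is the cell at `b`. [folklore] -/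
theorem signedLaw_iff_anySign :
    FlexNFCaseSKummerSignedLawThree ↔
      ∀ (a : ℕ) (b A₃ : ℤ), (a = 1 ∨ a = 2) → ¬ (3 : ℤ) ∣ A₃ →
        NFKummerHasRamified b A₃ a ∧
          ((cellS a (b * A₃)).k = 1 → NFKummerInLineOfA₃ b A₃ a) ∧ ((cellS a (b * A₃)).k = 2 → NFKummerHasUnit b A₃ a) := by
  refine ⟨fun h a b A₃ ha hA => kummerLawS_of_signed h a b A₃ ha hA, fun h a b A₃ ha h1 => ?_⟩
  have hc : cellS a (b * A₃) = cellS a b := cellS_congr a (by rw [Int.mul_emod, h1]; omega)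
  simpa only [hc] using h a b A₃ ha (by omega)

/-- The witness of the ERRATUM under the any-sign reading: `(a, b, A₃) = (1, 2, 2)` is read at `b·A₃ = 4 ≡ 1 (mod 3)`, the
`k = 2` (plane) cell — consistent with p18's unit point `(ξ, 4)`. [folklore] -/
example : (cellS 1 (2 * 2)).k = 2 ∧ (cellS 1 (2 * 2)).t = .P := by decide

end Sign

end Summit.BirchSwinnertonDyer.Rank1Residual.O5.FlexNormalForm
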